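import Summits.HubbardSuperconductivity.HubbardSuperconductivity.Theorems.NodalWardXYNodalReductionDefs

/-!
# Trial-state bound: crux `NodalReduction` (stmt-HubbardSuperconductivity-1268), line `Sketch`, stub `stub_trialStateBound`

The abstract Kaplan–Horsch–von der Linden / Koma–Tasaki trial-state variational inequality
`TrialStateBound` (statement (A) of `NodalWardXYNodalReductionDefs`), finite-dimensional linear algebra in
the tree's `Matrix`/`dotProduct` language.

Content. For Hermitian `K, O : Matrix n n ℂ`, a unit ground vector `Φ` of `K`
(`K Φ = E₀ Φ`, `E₀ = K.groundEnergy`) with `⟨Φ, OΦ⟩ = 0 = ⟨Φ, O³Φ⟩` and `s := ‖OΦ‖² > 0`, put `r := √s`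
and take the (unnormalised) trial vector `ξ := r • Φ + OΦ`. Then

* `⟨ξ, ξ⟩ = r² + s = 2s` (`⟨OΦ, Φ⟩ = ⟨Φ, OΦ⟩ = 0` by Hermiticity of `O`);
* `⟨ξ, Kξ⟩ = r² E₀ + ⟨OΦ, K OΦ⟩` (the cross terms vanish: `⟨Φ, K v⟩ = E₀ ⟨Φ, v⟩` for every `v`,
  by Hermiticity of `K` and the eigen-equation);
* `⟨ξ, Oξ⟩ = 2 r s` (`⟨Φ, O OΦ⟩ = ⟨OΦ, OΦ⟩ = s`, `⟨OΦ, O OΦ⟩ = ⟨Φ, O³Φ⟩ = 0`);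
* the double-commutator identity `⟨Φ, [[O,K],O] Φ⟩ = 2 ⟨OΦ, K OΦ⟩ - 2 E₀ s`
  (`[[O,K],O] = (OK - KO)O - O(OK - KO) = 2 OKO - KO² - O²K`).

The variational principle `E₀(A) ⟨ξ,ξ⟩ ≤ Re ⟨ξ, A ξ⟩` for `A = K - hO` then reads
`2s · E₀(K - hO) ≤ s E₀ + Re⟨OΦ, K OΦ⟩ - 2 h r s`, which is the claim after division by `2s`.
(The hypothesis `0 ≤ h` of the registered statement is not needed.)

Sources: T. Koma, H. Tasaki, J. Stat. Phys. 76 (1994) 745, proof of Theorem 2.2; T. Koma, H. Tasaki,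
Commun. Math. Phys. 158 (1993) 191, Theorem 7.1; T. A. Kaplan, P. Horsch, W. von der Linden,
J. Phys. Soc. Jpn. 58 (1989) 3894. The `ContinuousLinearMap` analogue of the double-commutator identity
is `Literature.MathematicalPhysics.QuantumLattice.KomaTasaki.horschVonDerLinden_holds`; here we mirror it
for matrices. Tree facts used: `Matrix.groundEnergy_le_rayleigh_holds` (variational principle) and
`isHermitian_sub_real_smul`.
-/

noncomputable section

-- `Summit.HubbardSuperconductivity.HubbardSuperconductivity.…` is the tree's summit/sub-problem namespace (D-0017).
set_option linter.dupNamespace false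

namespace Summit.HubbardSuperconductivity.HubbardSuperconductivity.Theorems.NodalReduction

open Matrix Literature.MathematicalPhysics.QuantumLattice
open scoped ComplexOrder

variable {n : Type*} [Fintype n]

/-- Moving a Hermitian matrix across the `dotProduct` pairing: `⟨OΦ, w⟩ = ⟨Φ, O w⟩`. -/
theorem tsb_adj {O : Matrix n n ℂ} (hO : O.IsHermitian) (Φ w : n → ℂ) :
    star (O *ᵥ Φ) ⬝ᵥ w = star Φ ⬝ᵥ (O *ᵥ w) := by
  rw [star_mulVec, hO.eq, ← dotProduct_mulVec]

/-- For a Hermitian `K` with `K Φ = E Φ` (`E` real): `⟨Φ, K w⟩ = E ⟨Φ, w⟩` for every `w`. -/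
theorem tsb_eigen {K : Matrix n n ℂ} (hK : K.IsHermitian) {Φ : n → ℂ} {E : ℝ}
    (hKΦ : K *ᵥ Φ = (E : ℂ) • Φ) (w : n → ℂ) :
    star Φ ⬝ᵥ (K *ᵥ w) = (E : ℂ) * (star Φ ⬝ᵥ w) := by
  rw [← tsb_adj hK, hKΦ, star_smul, smul_dotProduct, smul_eq_mul, Complex.star_def,
    Complex.conj_ofReal]

/-- `⟨v, v⟩` is real: `((star v ⬝ᵥ v).re : ℂ) = star v ⬝ᵥ v`. -/
theorem tsb_ofReal_re_star_dotProduct_self (v : n → ℂ) :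
    (((star v ⬝ᵥ v).re : ℝ) : ℂ) = star v ⬝ᵥ v := by
  obtain ⟨-, him⟩ := Complex.nonneg_iff.1 (dotProduct_star_self_nonneg v)
  exact Complex.ext (Complex.ofReal_re _) (by rw [Complex.ofReal_im]; exact him)

/-- The variational principle for an unnormalised trial vector: if `⟨ξ, ξ⟩ = t > 0` then
`E₀(A) · t ≤ Re ⟨ξ, A ξ⟩` (from `Matrix.groundEnergy_le_rayleigh_holds` applied to `ξ/√t`). -/
theorem tsb_groundEnergy_mul_le [DecidableEq n] {A : Matrix n n ℂ} (hA : A.IsHermitian)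
    (ξ : n → ℂ) {t : ℝ} (ht : 0 < t) (hξ : star ξ ⬝ᵥ ξ = (t : ℂ)) :
    A.groundEnergy * t ≤ (star ξ ⬝ᵥ (A *ᵥ ξ)).re := by
  obtain ⟨c, hct⟩ : ∃ c : ℝ, c * c * t = 1 :=
    ⟨(Real.sqrt t)⁻¹, by rw [← mul_inv, Real.mul_self_sqrt ht.le, inv_mul_cancel₀ ht.ne']⟩
  have hunit : star ((c : ℂ) • ξ) ⬝ᵥ ((c : ℂ) • ξ) = 1 := by
    rw [star_smul, smul_dotProduct, dotProduct_smul, hξ, Complex.star_def, Complex.conj_ofReal]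
    simp only [smul_eq_mul]
    rw [← mul_assoc]
    exact_mod_cast hct
  have key := groundEnergy_le_rayleigh_holds hA ((c : ℂ) • ξ) hunit
  rw [mulVec_smul, star_smul, smul_dotProduct, dotProduct_smul, Complex.star_def,
    Complex.conj_ofReal] at key
  simp only [smul_eq_mul] at key
  rw [← mul_assoc, ← Complex.ofReal_mul, Complex.re_ofReal_mul] at key
  calc A.groundEnergy * t ≤ c * c * (star ξ ⬝ᵥ (A *ᵥ ξ)).re * t :=
        mul_le_mul_of_nonneg_right key ht.le
    _ = (star ξ ⬝ᵥ (A *ᵥ ξ)).re * (c * c * t) := by ring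
    _ = (star ξ ⬝ᵥ (A *ᵥ ξ)).re := by rw [hct, mul_one]

/-- Norm of the trial vector `ξ = r • Φ + OΦ`: `⟨ξ, ξ⟩ = r² + ⟨OΦ, OΦ⟩` (unit `Φ`, `⟨Φ, OΦ⟩ = 0`). -/
theorem tsb_norm_trial {O : Matrix n n ℂ} (hO : O.IsHermitian) {Φ : n → ℂ}
    (hΦ : star Φ ⬝ᵥ Φ = 1) (h1 : star Φ ⬝ᵥ (O *ᵥ Φ) = 0) (r : ℝ) :
    star ((r : ℂ) • Φ + O *ᵥ Φ) ⬝ᵥ ((r : ℂ) • Φ + O *ᵥ Φ) =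
      ((r * r : ℝ) : ℂ) + star (O *ᵥ Φ) ⬝ᵥ (O *ᵥ Φ) := by
  have hvΦ : star (O *ᵥ Φ) ⬝ᵥ Φ = 0 := by rw [tsb_adj hO, h1]
  rw [star_add, star_smul, Complex.star_def, Complex.conj_ofReal]
  simp only [add_dotProduct, dotProduct_add, smul_dotProduct, dotProduct_smul, smul_eq_mul, hΦ, h1,
    hvΦ]
  push_cast
  ring

/-- Energy of the trial vector: `⟨ξ, Kξ⟩ = r² E + ⟨OΦ, K OΦ⟩` (the cross terms vanish). -/
theorem tsb_K_trial {K O : Matrix n n ℂ} (hK : K.IsHermitian) (hO : O.IsHermitian) {Φ : n → ℂ}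
    {E : ℝ} (hΦ : star Φ ⬝ᵥ Φ = 1) (hKΦ : K *ᵥ Φ = (E : ℂ) • Φ) (h1 : star Φ ⬝ᵥ (O *ᵥ Φ) = 0)
    (r : ℝ) :
    star ((r : ℂ) • Φ + O *ᵥ Φ) ⬝ᵥ (K *ᵥ ((r : ℂ) • Φ + O *ᵥ Φ)) =
      ((r * r * E : ℝ) : ℂ) + star (O *ᵥ Φ) ⬝ᵥ (K *ᵥ (O *ᵥ Φ)) := by
  have hvΦ : star (O *ᵥ Φ) ⬝ᵥ Φ = 0 := by rw [tsb_adj hO, h1]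
  have hΦKΦ : star Φ ⬝ᵥ (K *ᵥ Φ) = (E : ℂ) := by rw [tsb_eigen hK hKΦ, hΦ, mul_one]
  have hΦKv : star Φ ⬝ᵥ (K *ᵥ (O *ᵥ Φ)) = 0 := by rw [tsb_eigen hK hKΦ, h1, mul_zero]
  have hvKΦ : star (O *ᵥ Φ) ⬝ᵥ (K *ᵥ Φ) = 0 := by rw [hKΦ, dotProduct_smul, hvΦ, smul_zero]
  rw [star_add, star_smul, Complex.star_def, Complex.conj_ofReal, mulVec_add, mulVec_smul]
  simp only [add_dotProduct, dotProduct_add, smul_dotProduct, dotProduct_smul, smul_eq_mul,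
    hΦKΦ, hΦKv, hvKΦ]
  push_cast
  ring

/-- Order-operator expectation of the trial vector: `⟨ξ, Oξ⟩ = 2 r ⟨OΦ, OΦ⟩`
(`⟨Φ, OΦ⟩ = 0 = ⟨Φ, O³Φ⟩`). -/
theorem tsb_O_trial {O : Matrix n n ℂ} (hO : O.IsHermitian) {Φ : n → ℂ}
    (h1 : star Φ ⬝ᵥ (O *ᵥ Φ) = 0) (h3 : star Φ ⬝ᵥ ((O * O * O) *ᵥ Φ) = 0) (r : ℝ) :
    star ((r : ℂ) • Φ + O *ᵥ Φ) ⬝ᵥ (O *ᵥ ((r : ℂ) • Φ + O *ᵥ Φ)) =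
      ((2 * r : ℝ) : ℂ) * (star (O *ᵥ Φ) ⬝ᵥ (O *ᵥ Φ)) := by
  have hΦOv : star Φ ⬝ᵥ (O *ᵥ (O *ᵥ Φ)) = star (O *ᵥ Φ) ⬝ᵥ (O *ᵥ Φ) := (tsb_adj hO Φ _).symm
  have hvOv : star (O *ᵥ Φ) ⬝ᵥ (O *ᵥ (O *ᵥ Φ)) = 0 := by
    simp only [← mulVec_mulVec] at h3
    rw [tsb_adj hO, h3]
  rw [star_add, star_smul, Complex.star_def, Complex.conj_ofReal, mulVec_add, mulVec_smul]
  simp only [add_dotProduct, dotProduct_add, smul_dotProduct, dotProduct_smul, smul_eq_mul, h1,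
    hΦOv, hvOv]
  push_cast
  ring

/-- The double-commutator identity `⟨Φ, [[O,K],O] Φ⟩ = 2 ⟨OΦ, K OΦ⟩ - 2 E ⟨OΦ, OΦ⟩` for Hermitian
`K, O` and `K Φ = E Φ` (`[[O,K],O] = (OK - KO)O - O(OK - KO) = 2 OKO - KO² - O²K`). -/
theorem tsb_doubleComm {K O : Matrix n n ℂ} (hK : K.IsHermitian) (hO : O.IsHermitian) {Φ : n → ℂ}
    {E : ℝ} (hKΦ : K *ᵥ Φ = (E : ℂ) • Φ) :
    star Φ ⬝ᵥ ((((O * K - K * O) * O - O * (O * K - K * O))) *ᵥ Φ) =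
      ((2 : ℝ) : ℂ) * (star (O *ᵥ Φ) ⬝ᵥ (K *ᵥ (O *ᵥ Φ))) -
        ((2 * E : ℝ) : ℂ) * (star (O *ᵥ Φ) ⬝ᵥ (O *ᵥ Φ)) := by
  have hOKO : star Φ ⬝ᵥ (O *ᵥ (K *ᵥ (O *ᵥ Φ))) = star (O *ᵥ Φ) ⬝ᵥ (K *ᵥ (O *ᵥ Φ)) :=
    (tsb_adj hO Φ _).symm
  have hKOO : star Φ ⬝ᵥ (K *ᵥ (O *ᵥ (O *ᵥ Φ))) = (E : ℂ) * (star (O *ᵥ Φ) ⬝ᵥ (O *ᵥ Φ)) := by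
    rw [tsb_eigen hK hKΦ, ← tsb_adj hO Φ]
  have hOOK : star Φ ⬝ᵥ (O *ᵥ (O *ᵥ (K *ᵥ Φ))) = (E : ℂ) * (star (O *ᵥ Φ) ⬝ᵥ (O *ᵥ Φ)) := by
    rw [hKΦ, mulVec_smul, mulVec_smul, dotProduct_smul, smul_eq_mul, ← tsb_adj hO Φ]
  simp only [sub_mul, mul_sub, sub_mulVec, ← mulVec_mulVec, dotProduct_sub, hOKO, hKOO, hOOK]
  push_cast
  ring

/-- **(A) The Kaplan–Horsch–von der Linden / Koma–Tasaki trial-state inequality** (registered stub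
`stub_trialStateBound` of the line `Sketch`): for Hermitian `K, O`, a unit ground vector `Φ` of `K` with
`⟨Φ,OΦ⟩ = 0 = ⟨Φ,O³Φ⟩` and `OΦ ≠ 0`, and `h ≥ 0`,
`E₀(K − hO) ≤ E₀(K) + Re⟨Φ,[[O,K],O]Φ⟩/(4‖OΦ‖²) − h‖OΦ‖` — the variational principle for the trial
vector `‖OΦ‖ • Φ + OΦ` (Koma–Tasaki 1994, proof of Thm 2.2). -/
theorem stub_trialStateBound : TrialStateBound := by
  intro n _ _ K O hK hO Φ hΦ hKΦ h1 h3 hs h _hh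
  -- `s = ‖OΦ‖²` as a real number, `(s : ℂ) = ⟨OΦ, OΦ⟩`
  have hsS := tsb_ofReal_re_star_dotProduct_self (O *ᵥ Φ)
  obtain ⟨s, hs_def⟩ : ∃ s : ℝ, s = (star (O *ᵥ Φ) ⬝ᵥ (O *ᵥ Φ)).re := ⟨_, rfl⟩
  rw [← hs_def] at hs hsS ⊢
  -- `r = √s`
  obtain ⟨r, hr_def⟩ : ∃ r : ℝ, r = Real.sqrt s := ⟨_, rfl⟩
  have hrr : r * r = s := by rw [hr_def]; exact Real.mul_self_sqrt hs.le
  rw [← hr_def]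
  -- the trial vector
  obtain ⟨ξ, hξ⟩ : ∃ ξ : n → ℂ, ξ = (r : ℂ) • Φ + O *ᵥ Φ := ⟨_, rfl⟩
  have hnorm : star ξ ⬝ᵥ ξ = ((2 * s : ℝ) : ℂ) := by
    rw [hξ, tsb_norm_trial hO hΦ h1 r, ← hsS, ← hrr]
    push_cast
    ring
  have hKexp : (star ξ ⬝ᵥ (K *ᵥ ξ)).re =
      s * K.groundEnergy + (star (O *ᵥ Φ) ⬝ᵥ (K *ᵥ (O *ᵥ Φ))).re := by
    rw [hξ, tsb_K_trial hK hO hΦ hKΦ h1 r, Complex.add_re, Complex.ofReal_re, hrr]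
  have hOexp : (star ξ ⬝ᵥ (O *ᵥ ξ)).re = 2 * r * s := by
    rw [hξ, tsb_O_trial hO h1 h3 r, ← hsS, ← Complex.ofReal_mul, Complex.ofReal_re]
  have hD : (star Φ ⬝ᵥ ((((O * K - K * O) * O - O * (O * K - K * O))) *ᵥ Φ)).re =
      2 * (star (O *ᵥ Φ) ⬝ᵥ (K *ᵥ (O *ᵥ Φ))).re - 2 * K.groundEnergy * s := by
    rw [tsb_doubleComm hK hO hKΦ, ← hsS, Complex.sub_re, Complex.re_ofReal_mul, ← Complex.ofReal_mul,
      Complex.ofReal_re]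
  -- the variational principle for `K - hO` and the trial vector `ξ`
  have hA : (K - (h : ℂ) • O).IsHermitian := isHermitian_sub_real_smul hK hO h
  have h2s : 0 < 2 * s := by positivity
  have hvar := tsb_groundEnergy_mul_le hA ξ h2s hnorm
  rw [sub_mulVec, smul_mulVec, dotProduct_sub, dotProduct_smul, smul_eq_mul, Complex.sub_re,
    Complex.re_ofReal_mul, hKexp, hOexp] at hvar
  rw [hD]
  calc (K - (h : ℂ) • O).groundEnergy
      ≤ (s * K.groundEnergy + (star (O *ᵥ Φ) ⬝ᵥ (K *ᵥ (O *ᵥ Φ))).re - h * (2 * r * s)) /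
          (2 * s) := (le_div_iff₀ h2s).2 hvar
    _ = K.groundEnergy
          + (2 * (star (O *ᵥ Φ) ⬝ᵥ (K *ᵥ (O *ᵥ Φ))).re - 2 * K.groundEnergy * s) / (4 * s)
          - h * r := by
        field_simp
        ring

end Summit.HubbardSuperconductivity.HubbardSuperconductivity.Theorems.NodalReduction

end
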